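import Summits.BirchSwinnertonDyer.BirchSwinnertonDyer.Theorems.SylvesterTwoHeegnerIndexUpperConeOfPrintExact
import Literature.NumberTheory.EllipticCurves.HuShuYin2019.SylvesterNineQuotientParametrizationExists
import HarnessLib

/-!
# Route `SylvesterTwoHeegnerIndex` (rung K7t): the UPPER cone and (G3) from the NAMED print fact (G3′)
# `HuShuYin2019.exists_deg_eq_six_isS3Invariant` (crux `UpperOffV0HSYPlus` stmt-BirchSwinnertonDyer-19804, UPPER
# stmt-…-19725, hand item `HeegnerIndexUpperAtTwoHSY` stmt-…-19229)

Cell `bsd-cm`, seat `bsd-cm-k7t-c2` g35 (planner D852 (b)/D853: the by-name §).  THEOREMS ONLY — one-line restatements of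
`Theorems/SylvesterTwoHeegnerIndexUpperConeOfPrintExact.lean` (antecedent displayed) with the antecedent NAMED by
k-ty1 g20's Literature fact `exists_deg_eq_six_isS3Invariant` (p757202,
`Literature/…/HuShuYin2019/SylvesterNineQuotientParametrizationExists.lean`; definitionally the displayed body).
No definition, no named fact, no instance, no notation, no `sorry`.  `--supports stmt-BirchSwinnertonDyer-19804 --as helper`.

What is proved: ★★ `phi_s3Invariant_of_deg_eq_six_of_named : exists_deg_eq_six_isS3Invariant → phi_s3Invariant_of_deg_eq_six`
((G3) ⟸ (G3′) BY NAME); the books iff `exists_deg_eq_six_isS3Invariant ↔ (∃ Dt, Dt.deg = 6) ∧ phi_s3Invariant_of_deg_eq_six`;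
`printInputsTwo_of_named` (the registered PURE-CITE stub type `stub_printInputsTwo` of VARIANT S from `{(G3′), #19, #20}` —
the shape of the planner's VARIANT T); and the cone heads by name: crux 19804, UPPER 19725, the hand item 19229
(★★★ `heegnerIndexUpperAtTwoHSY_of_publishedFactsTwoPlus_of_named`), leaf `X12.CMAtTwo` modulo the OPEN LOWER half.

Honest label: bookkeeping; CONDITIONAL theorems (print inputs displayed); nothing asserted on 19804; no ledger item closed;
`X12.CMAtTwo` NOT proved; BSD proved for no curve.

References: Hu–Shu–Yin, Trans. AMS 372 (2019) = arXiv:1708.05266, Prop. 2.1 (1), §4.1 (p. 10 L59, p. 11 L23), Thm. 1.4,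
Cor. 4.4 [HuShuYin2019]; Nekovář 2007 Prop. 4.9 [Nekovar2007]; Fisher 2003 Prop. 2.16 [Fisher2003]; Milne ADT I §6
[MilneADT2006].
-/

set_option linter.dupNamespace false -- Summits modules are `Summit.<Summit>.<Problem>…` by design
set_option autoImplicit false

noncomputable section

open scoped Classical

open WeierstrassCurve
open Literature.NumberTheory.EllipticCurves Literature.NumberTheory.EllipticCurves.ModularForms
  Literature.NumberTheory.EllipticCurves.HuShuYin2019
open Summit.BirchSwinnertonDyer.BirchSwinnertonDyer.Theorems
  Summit.BirchSwinnertonDyer.BirchSwinnertonDyer.Theorems.SylvesterTwoUpperConePrintExact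

namespace Summit.BirchSwinnertonDyer.BirchSwinnertonDyer.Theorems.SylvesterTwoUpperConePrintExact

/-! ## §3 By name, from `HuShuYin2019.exists_deg_eq_six_isS3Invariant` -/

/-- ★★ **(G3) ⟸ (G3′) BY NAME**: the admitted binder `phi_s3Invariant_of_deg_eq_six` follows from the named print fact
`exists_deg_eq_six_isS3Invariant` (HSY Prop. 2.1 (1) + §4.1), by rigidity (`phi_s3Invariant_of_deg_eq_six_of_exists`).
[cite: HuShuYin2019, Prop. 2.1 (1) (p. 5 L59–L61, L76), §4.1 (p. 10 L59, p. 11 L23)] -/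
theorem phi_s3Invariant_of_deg_eq_six_of_named (h : exists_deg_eq_six_isS3Invariant) :
    phi_s3Invariant_of_deg_eq_six :=
  phi_s3Invariant_of_deg_eq_six_of_exists h

/-- **The books iff**: the named print fact (G3′) is EQUIVALENT to the conjunction of VARIANT S's first and fourth
conjuncts «∃ degree-6 datum» ∧ (G3). [cite: HuShuYin2019, Prop. 2.1 (1), §4.1 (p. 10 L59, p. 11 L23)] -/
theorem exists_deg_eq_six_isS3Invariant_iff :
    exists_deg_eq_six_isS3Invariant ↔
      (∃ Dt : ModularParametrizationData (⟨0, 0, 1, 0, -1⟩ : WeierstrassCurve ℚ) 243, Dt.deg = 6) ∧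
        phi_s3Invariant_of_deg_eq_six :=
  ⟨fun h ↦ ⟨let ⟨Dt, hdeg, _⟩ := h; ⟨Dt, hdeg⟩, phi_s3Invariant_of_deg_eq_six_of_exists h⟩,
    fun h ↦ h.2.exists_of_exists h.1⟩

/-- **VARIANT S's `stub_printInputsTwo` type from `{(G3′) named, #19, #20}`** — the shape of the planner's VARIANT T
(`stub_printInputsTwo := exists_deg_eq_six_isS3Invariant ∧ #19 ∧ #20`, conjunct 1 and (G3) derived in-file).
[cite: HuShuYin2019, Thm. 1.4, Cor. 4.4, display (bsd) p. 12, Prop. 2.1 (1), §4.1] [cite: Nekovar2007, Prop. 4.9] -/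
theorem printInputsTwo_of_named (hG3' : exists_deg_eq_six_isS3Invariant)
    (hD : shaAnPair_mul_height_eq_two_zpow_mul_height_named) (hES2 : Nekovar2007.cmPoint_frobeniusCongruence) :
    (∃ Dt : ModularParametrizationData (⟨0, 0, 1, 0, -1⟩ : WeierstrassCurve ℚ) 243, Dt.deg = 6) ∧
      shaAnPair_mul_height_eq_two_zpow_mul_height_named ∧ Nekovar2007.cmPoint_frobeniusCongruence ∧
      phi_s3Invariant_of_deg_eq_six :=
  printInputsTwo_of_exists_isS3Invariant hG3' hD hES2

/-- ★★ **The crux `UpperOffV0HSYPlus` (item 19804) BY NAME from `{(G3′) named, #19, #20, VII}`.**  CONDITIONAL; BSD is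
proved for no curve. [cite: HuShuYin2019, Thm. 1.4, Cor. 4.4, Prop. 2.1 (1), §4.1] [cite: Nekovar2007, Prop. 4.9]
[cite: Fisher2003, Prop. 2.16 (JNT 98, p. 132)] [cite: MilneADT2006, Ch. I §6 Prop. 6.9, Thm. 6.13(a)] -/
theorem upperOffV0HSYPlus_of_named (hG3' : exists_deg_eq_six_isS3Invariant)
    (hD : shaAnPair_mul_height_eq_two_zpow_mul_height_named) (hES2 : Nekovar2007.cmPoint_frobeniusCongruence)
    (hVII : ∀ (K : Type) [Field K] [NumberField K] (σ₀ : K ≃ₐ[ℚ] K) (h2 : Module.finrank ℚ K = 2) (hσ₀ : σ₀ ≠ 1),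
      casselsTate_canonical_adjoint K σ₀ h2 hσ₀) :
    Summit.BirchSwinnertonDyer.BirchSwinnertonDyer.Theses.SylvesterTwoHeegnerIndex.UpperOffV0HSYPlus :=
  upperOffV0HSYPlus_of_exists_isS3Invariant hG3' hD hES2 hVII

/-- ★★ **UPPER `HeegnerIndexUpperAtTwoHSYOfFactsPlus` (item 19725) BY NAME from `{(G3′) named, #19, #20, VII}`.**
CONDITIONAL; BSD is proved for no curve. [cite: HuShuYin2019, Thm. 1.4, Cor. 4.4, Prop. 2.1 (1), §4.1]
[cite: Nekovar2007, Prop. 4.9] [cite: Fisher2003, Prop. 2.16 (JNT 98, p. 132)] -/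
theorem heegnerIndexUpperAtTwoHSYOfFactsPlus_of_named (hG3' : exists_deg_eq_six_isS3Invariant)
    (hD : shaAnPair_mul_height_eq_two_zpow_mul_height_named) (hES2 : Nekovar2007.cmPoint_frobeniusCongruence)
    (hVII : ∀ (K : Type) [Field K] [NumberField K] (σ₀ : K ≃ₐ[ℚ] K) (h2 : Module.finrank ℚ K = 2) (hσ₀ : σ₀ ≠ 1),
      casselsTate_canonical_adjoint K σ₀ h2 hσ₀) :
    Summit.BirchSwinnertonDyer.BirchSwinnertonDyer.Theses.SylvesterTwoHeegnerIndex.HeegnerIndexUpperAtTwoHSYOfFactsPlus :=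
  heegnerIndexUpperAtTwoHSYOfFactsPlus_of_exists_isS3Invariant hG3' hD hES2 hVII

/-- ★★★ **The hand item `HeegnerIndexUpperAtTwoHSY` (stmt-BirchSwinnertonDyer-19229) BY NAME from `PublishedFactsTwoPlus`
+ the NAMED print facts `{(G3′), #19, #20, VII}`** — every hypothesis is now a cite-tagged Literature name or a displayed
print fact; the admitted `∀`-binder (G3) is gone.  CONDITIONAL; closes no ledger item; BSD is proved for no curve.
[cite: HuShuYin2019, Thm. 1.4, Cor. 4.4, display (bsd) p. 12, Prop. 2.1 (1), §4.1] [cite: Nekovar2007, Prop. 4.9]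
[cite: Fisher2003, Prop. 2.16 (JNT 98, p. 132)] [cite: MilneADT2006, Ch. I §6 Prop. 6.9, Thm. 6.13(a)]
[cite: GrossZagier1986, V §2] [cite: Kolyvagin1990, Thm. A] -/
theorem heegnerIndexUpperAtTwoHSY_of_publishedFactsTwoPlus_of_named
    (hF : Summit.BirchSwinnertonDyer.BirchSwinnertonDyer.Theses.SylvesterTwoHeegnerIndex.PublishedFactsTwoPlus)
    (hG3' : exists_deg_eq_six_isS3Invariant)
    (hD : shaAnPair_mul_height_eq_two_zpow_mul_height_named) (hES2 : Nekovar2007.cmPoint_frobeniusCongruence)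
    (hVII : ∀ (K : Type) [Field K] [NumberField K] (σ₀ : K ≃ₐ[ℚ] K) (h2 : Module.finrank ℚ K = 2) (hσ₀ : σ₀ ≠ 1),
      casselsTate_canonical_adjoint K σ₀ h2 hσ₀) :
    Summit.BirchSwinnertonDyer.BirchSwinnertonDyer.Theses.SylvesterTwoHeegnerIndex.HeegnerIndexUpperAtTwoHSY :=
  heegnerIndexUpperAtTwoHSY_of_publishedFactsTwoPlus_of_exists_isS3Invariant hF hG3' hD hES2 hVII

/-- ★★★ **The rung leaf `X12.CMAtTwo` ⟸ the OPEN LOWER half + `PublishedFactsTwoPlus` + the named prints `{(G3′), #19, #20, VII}`.**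
CONDITIONAL; `X12.CMAtTwo` is NOT proved; BSD is proved for no curve.
[cite: HuShuYin2019, Thm. 1.4, Cor. 4.4, Prop. 2.1 (1), §4.1] [cite: Nekovar2007, Prop. 4.9]
[cite: Fisher2003, Prop. 2.16 (JNT 98, p. 132)] [cite: GrossZagier1986, I (6.5), V §2] -/
theorem cmAtTwo_of_lower_of_publishedFactsTwoPlus_of_named
    (hlo : Summit.BirchSwinnertonDyer.BirchSwinnertonDyer.Theses.SylvesterTwoHeegnerIndex.HeegnerIndexLowerAtTwoHSY)
    (hF : Summit.BirchSwinnertonDyer.BirchSwinnertonDyer.Theses.SylvesterTwoHeegnerIndex.PublishedFactsTwoPlus)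
    (hG3' : exists_deg_eq_six_isS3Invariant)
    (hD : shaAnPair_mul_height_eq_two_zpow_mul_height_named) (hES2 : Nekovar2007.cmPoint_frobeniusCongruence)
    (hVII : ∀ (K : Type) [Field K] [NumberField K] (σ₀ : K ≃ₐ[ℚ] K) (h2 : Module.finrank ℚ K = 2) (hσ₀ : σ₀ ≠ 1),
      casselsTate_canonical_adjoint K σ₀ h2 hσ₀) :
    Summit.BirchSwinnertonDyer.Rank1Residual.X12.CMAtTwo :=
  cmAtTwo_of_lower_of_publishedFactsTwoPlus_of_exists_isS3Invariant hlo hF hG3' hD hES2 hVII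

end Summit.BirchSwinnertonDyer.BirchSwinnertonDyer.Theorems.SylvesterTwoUpperConePrintExact

end
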